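import Literature.NumberTheory.IwasawaTheory.ClassicalMuVanishesCyclicAscentOddShift
import Literature.NumberTheory.IwasawaTheory.ClassicalMuVanishesPExtensionAscentOddCyclotomicBase
import Literature.NumberTheory.IwasawaTheory.ClassicalMuVanishesReflectionDescent
import Literature.NumberTheory.IwasawaTheory.ClassicalMuVanishesFiniteDescentNoGrowth
import Literature.NumberTheory.IwasawaTheory.ClassicalMuVanishesIffBoundedRank
import Literature.NumberTheory.IwasawaTheory.ClassicalMuVanishesBoundedRankProofs
import Mathlib.GroupTheory.IndexNormal
import Mathlib.GroupTheory.Sylow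
import HarnessLib

/-!
# `μ_p = 0` for EVERY finite Galois `p`-power extension of `ℚ`, `p` odd, and every cyclotomic `ℤ_p`-extension — Iwasawa 1973 Thm. 3 + Iwasawa 1956
# with NO linear-disjointness proviso (`ℚ_n ⊂ ℚ(ζ_{p^{n+1}})`, `ℚ(ζ_{p²})⁺`-type fields included; proved, no definition, no named fact)

`Proofs`-style file (theorems only, no `sorry`) in topic `NumberTheory/IwasawaTheory` (namespace `Literature.NumberTheory.IwasawaTheory`),
written by the prover seat `bsd-line-att-p3` g36 (cell `bsd-f1-sign2`; LIBRARY PASS, odd-`p` twin of this seat's `ClassicalMuVanishesTwoPowerGaloisRatFull`;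
closes nothing; nothing about elliptic curves or BSD is asserted).  Sequel of `ClassicalMuVanishesCyclicAscentOddShift` (the per-layer bound for
`K_m ⊆ j''(K')·K_m`, every `m`, no surjectivity).  It removes the «`κ ∘ res` onto» (`K' ∩ ℚ_∞ = ℚ`) binders of bsd-potss's
`ClassicalMuVanishesCyclicAscentOddRelative` / `ClassicalMuVanishesPExtensionAscentOdd` / `…OddCyclotomicBase`: Iwasawa's statements verbatim.

* §1 ★★★ **`classicalMu_of_isGalois_of_finrank_eq_odd_prime`** — `p` odd, `K ⊆ K'` number fields, `K'/K` GALOIS OF DEGREE `p`: «`ClassicalMuVanishes`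
  for every cyclotomic `ℤ_p`-extension of `K`» ⟹ «the same for `K'`» (Iwasawa 1973 Thm. 2, `ℓ` odd, intrinsic, NO proviso: the shifted towers
  `κ₁` of `K` and `κ₁'` of `K'`, bounded `p`-ranks of the `K_m` carried to the `j''(K')·K_{n+a'} ≅ K'_n`).
* §2 ★★★ **`classicalMu_of_isGalois_of_finrank_eq_odd_prime_pow`** — `K'/K` Galois of degree `p^m` (Thm. 3, `ℓ` odd; normal series of the `p`-group).
* §3 ★★★ **`classicalMuVanishes_of_isGalois_rat_of_finrank_eq_odd_prime_pow`** — every finite Galois `p`-power extension `K'/ℚ`, every cyclotomic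
  `ℤ_p`-extension (`μ_p(ℚ) = 0`: Iwasawa 1956, tree `classicalMuVanishes_rat`); with this seat's `p = 2` file: **Iwasawa's theorem «`μ_l = 0` for every
  finite Galois `l`-extension of `ℚ`» is a kernel theorem for EVERY prime `l`**; `classicalMuVanishes_of_algebra_isGalois_rat_of_finrank_eq_odd_prime_pow`
  (every number field EMBEDDING in such a `K'`, e.g. non-Galois `ℚ(2^{1/p}) ⊄` — NOT an example; examples: all subfields of `p`-power Galois fields).
* §4 over a regular `p`-th cyclotomic base, no proviso: `classicalMu_of_isGalois_of_finrank_eq_prime_pow_over_cyclotomic_of_not_dvd_classNumber`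
  (`K ⊇ ℚ(ζ_p)` with `p ∤ h(K)`, `K'/K` Galois `p`-power — `ℚ(ζ_{p^{k+1}})`, Kummer towers `ℚ(ζ_p, a^{1/p}, …)`), `…_three` (fact-free).

References: [Iwasawa1973MuInvariants] Thm. 2, Thm. 3, §3–§4; [Iwasawa1956]; [Washington1997] §13.1, §13.3 Prop. 13.23, Prop. 13.22, Thm. 7.15;
[Lang1990] Ch. 13 §4; [Greenberg2001IwasawaPastPresent] Prop. 2.1 and p. 342.
-/

set_option autoImplicit false

noncomputable section

open scoped NumberField Classical
open NumberField Field IntermediateField IsDedekindDomain Module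

namespace Literature.NumberTheory.IwasawaTheory

open Literature.NumberTheory.EllipticCurves Literature.NumberTheory.EllipticCurves.ZpExtension
  Literature.NumberTheory.GaloisRepresentations Literature.NumberTheory.NumberFields

variable {p : ℕ} [hp : Fact p.Prime]

/-! ## §1 The cyclic degree-`p` step, intrinsic and proviso-free -/

/-- ★★★ **Iwasawa 1973 Thm. 2 (ℓ odd), verbatim: `μ_p = 0` ascends every Galois extension `K ⊆ K'` of odd prime degree `p`** — for the cyclotomic
`ℤ_p`-extensions, with NO hypothesis on `K ∩ ℚ_∞` or `K' ∩ K_∞`.  If `ClassicalMuVanishes κK` for every cyclotomic `ℤ_p`-extension `κK` of `K`, then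
`ClassicalMuVanishes κ'` for every cyclotomic `ℤ_p`-extension `κ'` of `K'`.  Proof: `κ₁` = shift of the cyclotomic `κ` of `ℚ` to `K` (cyclotomic,
layers `K_m` with boundedly many primes over each `q`), `κ₁'` = shift of `κ₁` to `K'` (cyclotomic, layers `≅ j''(K')·K_{n+a'}`); `μ(κ₁) = 0` bounds
`rank_p Cl(K_m)`; the prequel's per-layer bound gives bounded `rank_p Cl(j''(K')·K_m)`, hence `μ(κ₁') = 0`, shared by every cyclotomic `κ'`.
[cite: Iwasawa1973MuInvariants, Thm. 2 (ℓ odd) and §3] [cite: Washington1997, §13.1 and §13.3 Prop. 13.23] -/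
theorem classicalMu_of_isGalois_of_finrank_eq_odd_prime (hodd : p ≠ 2) (K K' : Type) [Field K] [NumberField K] [Field K']
    [NumberField K'] [Algebra K K'] [IsGalois K K'] (hdeg : Module.finrank K K' = p)
    (hμ : ∀ κK : ZpExtension K p, κK.IsCyclotomic → ClassicalMuVanishes κK) :
    ∀ κ' : ZpExtension K' p, κ'.IsCyclotomic → ClassicalMuVanishes κ' := by
  intro κ' hκ'
  haveI : IsScalarTower ℚ K K' := IsScalarTower.of_algebraMap_eq' (Subsingleton.elim _ _)
  haveI : FiniteDimensional K K' := Module.Finite.of_restrictScalars_finite ℚ K K'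
  obtain ⟨κ, hκ⟩ := exists_cyclotomicZpExtension_holds ℚ p
  -- the shifted towers of `K` (from `ℚ`) and of `K'` (from `K`)
  obtain ⟨a, κ₁, hs⟩ := exists_zpExtension_shift κ K
  have hκ₁ : κ₁.IsCyclotomic := isCyclotomic_of_shift κ K κ₁ hs hκ
  obtain ⟨a', κ₁', hs'⟩ := exists_zpExtension_shift κ₁ K'
  have hκ₁' : κ₁'.IsCyclotomic := isCyclotomic_of_shift κ₁ K' κ₁' hs' hκ₁
  refine (classicalMuVanishes_iff_of_isCyclotomic κ₁' κ' hκ₁' hκ').mp ?_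
  obtain ⟨R, hR⟩ := exists_forall_classGroupPRank_le_of_classicalMuVanishes κ₁ (hμ κ₁ hκ₁)
  set j'' : K' →ₐ[K] AlgebraicClosure K := absEmbedding K K' with hj''
  set T : ℕ := Module.finrank ℚ K * ∑ q ∈ (NumberField.discr K').natAbs.primeFactors, (q ^ (p - 1) - 1) * (p - 1) with hT
  refine classicalMuVanishes_of_forall_classGroupPRank_le κ₁' (B := p * (2 * R + T)) fun n ↦ ?_
  rw [classGroupPRank_eq_of_layerSubgroup_eq κ₁ K' κ₁' (layerSubgroup_eq_comap_of_shift κ₁ K' κ₁' hs' n) j'']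
  have h := padicValNat_card_quotient_fieldRange_sup_layer_le_odd hodd hκ K K' hdeg κ₁ hs j'' (n + a')
  have h2 : p * (2 * classGroupPRank κ₁ (n + a') + T) ≤ p * (2 * R + T) :=
    Nat.mul_le_mul_left p (Nat.add_le_add_right (Nat.mul_le_mul_left 2 (hR (n + a'))) T)
  exact h.trans h2

/-! ## §2 The `p`-power Galois ascent — Iwasawa 1973 Thm. 3 (ℓ odd), no proviso -/

/-- ★★★ **Iwasawa 1973 Thm. 3 (ℓ odd): `μ_p = 0` ascends every finite GALOIS `p`-POWER extension `K'/K`**, for the cyclotomic `ℤ_p`-extensions,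
ANY base number field `K`, NO linear-disjointness proviso: induction along a normal series of the `p`-group `Gal(K'/K)` (a Sylow subgroup of
order `p^m` has index `p` = least prime factor, hence is normal; §1 for `K ⊆ K'^H`, induction for `K'/K'^H`).
[cite: Iwasawa1973MuInvariants, Thm. 3 (ℓ odd)] [cite: Washington1997, §13.3 Prop. 13.23] -/
theorem classicalMu_of_isGalois_of_finrank_eq_odd_prime_pow (hodd : p ≠ 2) :
    ∀ (m : ℕ) (K K' : Type) [Field K] [NumberField K] [Field K'] [NumberField K'] [Algebra K K']
      [IsGalois K K'], Module.finrank K K' = p ^ m →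
      (∀ κK : ZpExtension K p, κK.IsCyclotomic → ClassicalMuVanishes κK) →
      ∀ κ' : ZpExtension K' p, κ'.IsCyclotomic → ClassicalMuVanishes κ' := by
  have hpp : p.Prime := hp.out
  intro m
  induction m with
  | zero =>
    intro K K' _ _ _ _ _ _ hdeg hμ κ' hκ'
    haveI : IsScalarTower ℚ K K' := IsScalarTower.of_algebraMap_eq' (Subsingleton.elim _ _)
    haveI : FiniteDimensional K K' := Module.Finite.of_restrictScalars_finite ℚ K K'
    have hsurj : Function.Surjective (algebraMap K K') := fun x => by
      have hx : x ∈ (⊥ : Subalgebra K K') := by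
        rw [Subalgebra.bot_eq_top_of_finrank_eq_one (by rw [hdeg, pow_zero])]; exact Algebra.mem_top
      exact Algebra.mem_bot.mp hx
    let e : K ≃+* K' := RingEquiv.ofBijective (algebraMap K K') ⟨(algebraMap K K').injective, hsurj⟩
    letI : Algebra K' K := e.symm.toRingHom.toAlgebra
    exact classicalMuVanishes_of_isCyclotomic_of_finite_noGrowth κ' hκ' K hμ
  | succ m ih =>
    intro K K' _ _ _ _ _ _ hdeg hμ κ' hκ'
    haveI : IsScalarTower ℚ K K' := IsScalarTower.of_algebraMap_eq' (Subsingleton.elim _ _)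
    haveI : FiniteDimensional K K' := Module.Finite.of_restrictScalars_finite ℚ K K'
    -- a normal subgroup of index `p`
    have hcardG : Nat.card (K' ≃ₐ[K] K') = p ^ (m + 1) := by rw [IsGalois.card_aut_eq_finrank, hdeg]
    obtain ⟨H, hH⟩ := Sylow.exists_subgroup_card_pow_prime p (n := m) (G := K' ≃ₐ[K] K')
      (by rw [hcardG]; exact pow_dvd_pow p (Nat.le_succ m))
    have hindex : H.index = p := by
      have h1 := H.index_mul_card
      rw [hH, hcardG, pow_succ, mul_comm (p ^ m) p] at h1
      exact Nat.eq_of_mul_eq_mul_right (pow_pos hpp.pos m) h1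
    haveI : H.Normal := Subgroup.normal_of_index_eq_minFac_card (by
      rw [hindex, hcardG, Nat.pow_minFac (Nat.succ_ne_zero m), hpp.minFac_eq])
    -- the intermediate field `M = K'^H`
    set M : IntermediateField K K' := IntermediateField.fixedField H with hM
    haveI : NumberField ↥M := NumberField.of_module_finite K ↥M
    haveI : IsGalois ↥M K' := IsGalois.tower_top_of_isGalois K ↥M K'
    have hMK' : Module.finrank ↥M K' = p ^ m := by rw [hM, IntermediateField.finrank_fixedField_eq_card, hH]
    have hKM : Module.finrank K ↥M = p := by
      have h1 := Module.finrank_mul_finrank K ↥M K'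
      rw [hMK', hdeg, pow_succ, mul_comm (p ^ m) p] at h1
      exact Nat.eq_of_mul_eq_mul_right (pow_pos hpp.pos m) h1
    -- `M/K` is Galois of degree `p` (`H` normal)
    haveI : IsGalois K ↥M := IsGalois.of_fixedField_normal_subgroup H
    have hμM : ∀ κM : ZpExtension ↥M p, κM.IsCyclotomic → ClassicalMuVanishes κM :=
      classicalMu_of_isGalois_of_finrank_eq_odd_prime hodd K ↥M hKM hμ
    exact ih ↥M K' hMK' hμM κ' hκ'

/-! ## §3 Every finite Galois `p`-power extension of `ℚ` -/

/-- ★★★ **`μ_p = 0` for EVERY finite Galois `p`-power extension of `ℚ` (`p` odd) and every cyclotomic `ℤ_p`-extension — Iwasawa 1973 Thm. 3 + Iwasawa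
1956, verbatim, NO proviso.**  `K'/ℚ` Galois with `[K' : ℚ] = p^m`, `κ'` any cyclotomic `ℤ_p`-extension of `K'`: `ClassicalMuVanishes κ'`.  Base:
every `ℤ_p`-extension of `ℚ` has `e_n = 0` (`classicalMuVanishes_rat`).  The layers `ℚ_n` of `ℚ_∞`, the degree-`p^m` subfields of `ℚ(ζ_{p^{m+1}})`
and of `ℚ(ζ_N)` generally, non-abelian `p`-groups — all included; fact-free, no `L`-functions.  Together with
`classicalMuVanishes_of_isGalois_rat_of_finrank_eq_two_pow'` (`p = 2`): Iwasawa's «`μ_l = 0` for every finite Galois `l`-extension of `ℚ`», every `l`.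
[cite: Iwasawa1973MuInvariants, Thm. 3 and §4] [cite: Washington1997, §13.3 Prop. 13.23 and Prop. 13.22] -/
theorem classicalMuVanishes_of_isGalois_rat_of_finrank_eq_odd_prime_pow (hodd : p ≠ 2) (K' : Type) [Field K'] [NumberField K']
    [IsGalois ℚ K'] (m : ℕ) (hdeg : Module.finrank ℚ K' = p ^ m) (κ' : ZpExtension K' p) (hκ' : κ'.IsCyclotomic) :
    ClassicalMuVanishes κ' :=
  classicalMu_of_isGalois_of_finrank_eq_odd_prime_pow hodd m ℚ K' hdeg (fun κP _ ↦ classicalMuVanishes_rat κP) κ' hκ'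

/-- ★★ **`μ_p = 0` for every number field that EMBEDS into a finite Galois `p`-power extension of `ℚ`** (`p` odd; equivalently: whose Galois closure
over `ℚ` has `p`-power degree — every subfield of a `p`-power Galois field, NOT assumed Galois) and every cyclotomic `ℤ_p`-extension of it: §3 on the
big field and the hI-free finite descent. [cite: Iwasawa1973MuInvariants, §3 (remark after Thm. 2) and Thm. 3] [cite: Washington1997, Prop. 4.11 and §13.3 Prop. 13.23] -/
theorem classicalMuVanishes_of_algebra_isGalois_rat_of_finrank_eq_odd_prime_pow (hodd : p ≠ 2) (K' L : Type) [Field K']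
    [NumberField K'] [Field L] [NumberField L] [Algebra K' L] [IsGalois ℚ L] (m : ℕ) (hdeg : Module.finrank ℚ L = p ^ m)
    (κ' : ZpExtension K' p) (hκ' : κ'.IsCyclotomic) : ClassicalMuVanishes κ' :=
  classicalMuVanishes_of_isCyclotomic_of_finite_noGrowth κ' hκ' L
    (fun κL hκL ↦ classicalMuVanishes_of_isGalois_rat_of_finrank_eq_odd_prime_pow hodd L m hdeg κL hκL)

/-- ★★ **`μ_p = 0` for the layers `ℚ_n` of the cyclotomic `ℤ_p`-extension of `ℚ` themselves** (`p` odd; `ℚ_n ⊂ ℚ(ζ_{p^{n+1}})`, Galois of degree `p^n`,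
`ℚ_n ∩ ℚ_∞ = ℚ_n` — the extreme failure of the old proviso) and every cyclotomic `ℤ_p`-extension of `ℚ_n`.
[cite: Iwasawa1973MuInvariants, Thm. 3] [cite: Washington1997, Prop. 13.22] -/
theorem classicalMuVanishes_layer_rat_odd (hodd : p ≠ 2) (κ : ZpExtension ℚ p) (n : ℕ)
    (κ' : ZpExtension ↥(κ.layer n) p) (hκ' : κ'.IsCyclotomic) :
    (haveI : FiniteDimensional ℚ ↥(κ.layer n) := κ.finiteDimensional_layer_holds n
     haveI : NumberField ↥(κ.layer n) := NumberField.of_module_finite ℚ _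
     ClassicalMuVanishes κ') := by
  haveI : FiniteDimensional ℚ ↥(κ.layer n) := κ.finiteDimensional_layer_holds n
  haveI : NumberField ↥(κ.layer n) := NumberField.of_module_finite ℚ _
  haveI : IsGalois ℚ ↥(κ.layer n) := κ.isGalois_layer_holds n
  exact classicalMuVanishes_of_isGalois_rat_of_finrank_eq_odd_prime_pow hodd ↥(κ.layer n) n (κ.finrank_layer_holds n) κ' hκ'

/-! ## §4 Over a regular `p`-th cyclotomic base, no proviso -/

/-- ★★ **`μ_p = 0` for every finite Galois `p`-power extension `K'` of a `p`-th cyclotomic field `K ≅ ℚ(ζ_p)` with `p ∤ h(K)` (`p` odd, regular),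
and every cyclotomic `ℤ_p`-extension of `K'` — NO «`K' ∩ ℚ_∞ = ℚ`» proviso** (bsd-potss's `…OddCyclotomicBase` had it): e.g. `ℚ(ζ_{p^{k+1}})`, the
Kummer fields `ℚ(ζ_p, a^{1/p})` and towers of such steps Galois over `K`, the `p`-division fields `ℚ(E[p]) ⊇ ℚ(ζ_p)` of `p`-power degree over it.
Base: `e_n = 0` for every `ℤ_p`-extension of `K` (Iwasawa 1956, tree `classicalMuVanishes_of_isCyclotomicExtension_prime`); ascent §2.
[cite: Iwasawa1973MuInvariants, Thm. 3] [cite: Washington1997, §13.3 Prop. 13.23 and Thm. 7.15] [cite: Greenberg2001IwasawaPastPresent, p. 342] -/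
theorem classicalMu_of_isGalois_of_finrank_eq_prime_pow_over_cyclotomic_of_not_dvd_classNumber (hodd : p ≠ 2)
    (K : Type) [Field K] [NumberField K] [IsCyclotomicExtension {p} ℚ K] (hreg : ¬ p ∣ NumberField.classNumber K)
    (m : ℕ) (K' : Type) [Field K'] [NumberField K'] [Algebra K K'] [IsGalois K K'] (hdeg : Module.finrank K K' = p ^ m)
    (κ' : ZpExtension K' p) (hκ' : κ'.IsCyclotomic) : ClassicalMuVanishes κ' :=
  classicalMu_of_isGalois_of_finrank_eq_odd_prime_pow hodd m K K' hdeg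
    (fun κP _ ↦ classicalMuVanishes_of_isCyclotomicExtension_prime p K hreg κP) κ' hκ'

/-- ★★ **`p = 3`, fact-free**: every finite Galois `3`-power extension `K'` of a third cyclotomic field `K ≅ ℚ(√−3)` (`h(K) = 1`), every cyclotomic
`ℤ₃`-extension of `K'`: `μ₃ = 0` — e.g. `ℚ(ζ_{3^{k+1}})`, `ℚ(ζ₃, a^{1/3})`, the `3`-division fields `ℚ(E[3])` of elliptic curves with a rational
`3`-isogeny kernel defined over `ℚ(ζ₃)`… (no linear-disjointness binder). [cite: Iwasawa1973MuInvariants, Thm. 3]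
[cite: Washington1997, §11.5 (h(ℚ(ζ₃)) = 1) and §13.3 Prop. 13.23] -/
theorem classicalMu_of_isGalois_of_finrank_eq_three_pow_over_cyclotomic_three [Fact (3 : ℕ).Prime]
    (K : Type) [Field K] [NumberField K] [IsCyclotomicExtension {3} ℚ K]
    (m : ℕ) (K' : Type) [Field K'] [NumberField K'] [Algebra K K'] [IsGalois K K'] (hdeg : Module.finrank K K' = 3 ^ m)
    (κ' : ZpExtension K' 3) (hκ' : κ'.IsCyclotomic) : ClassicalMuVanishes κ' :=
  classicalMu_of_isGalois_of_finrank_eq_prime_pow_over_cyclotomic_of_not_dvd_classNumber (by decide) K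
    (by rw [classNumber_eq_one_of_isCyclotomicExtension_three K]; decide) m K' hdeg κ' hκ'

end Literature.NumberTheory.IwasawaTheory

end
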